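import Literature.Analysis.OperatorTheory.HalfLinePositiveDefiniteHolomorphic
import Literature.MathematicalPhysics.QuantumFieldTheory.MirrorRPKernel
import HarnessLib

/-!
# Stub S1 `stub_halfPlaneContinuation` of line `xray-mellin-transfer` for crux `HRP2Rigidity`
# (stmt-CriticalPhenomena-1979): per-mirror half-plane continuation of a reflection-positive kernel

Statement (registered verbatim on stmt-CriticalPhenomena-1979 and stmt-CriticalPhenomena-4800).  Let `E`
be a real inner product space, `K : E → ℝ` even, bounded on every closed half-space
`{⟪x, n̂⟫ ≥ t₀}` (`t₀ > 0`), invariant under the mirror `θ_n` and reflection positive for it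
(`IsMirrorRPKernel n K`), `n ≠ 0`, and `y ⊥ n`.  Then `t ↦ K (t n̂ + y)` (`t > 0`) is the restriction
of a function holomorphic on `{Re t > 0}` dominated there by `K ((Re t) n̂)`.  (Continuity of `K` is
among the registered hypotheses but is not needed.)

Proof.  The `2m`-point configurations `{s_a n̂} ∪ {s_a n̂ - y}` (`s_a > 0`, all in the open
half-space) have the reflection-positivity Gram matrix `[[A, B], [B, A]]` with
`A_ab = K ((s_a + s_b) n̂)` and `B_ab = K ((s_a + s_b) n̂ + y)` (evenness and `θ_n`-invariance give
`K (s n̂ - y) = K (s n̂ + y)`), so the coefficient vectors `(c, ±c)` show that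
`F_± (s) := K (s n̂) ± K (s n̂ + y)` are positive definite on the semigroup `((0,∞), +)`; they are
bounded on `[t₀, ∞)` by the slab hypothesis.  By the tree's half-plane form of the
Bernstein–Widder/BCR Laplace representation of bounded positive-definite functions on the half-line
(`Literature.Analysis.OperatorTheory.IsBoundedHalfLinePD.exists_holomorphic_extension`, proved via
the GNS shift semigroup and the spectral theorem) each `F_±` extends to `Φ_±` holomorphic on
`{Re > 0}` with `‖Φ_± (t)‖ ≤ F_± (Re t)`; `F := (Φ₊ - Φ₋)/2` extends `K (t n̂ + y)` and
`‖F t‖ ≤ (F₊ + F₋)(Re t)/2 = K ((Re t) n̂)`.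

References: C. Berg, J. P. R. Christensen, P. Ressel, *Harmonic Analysis on Semigroups* (1984),
Ch. 4 §1–§4; D. V. Widder, *The Laplace Transform* (1941), Thm VI.21.
-/

noncomputable section

open scoped BigOperators InnerProductSpace
open Literature.MathematicalPhysics.QuantumFieldTheory Literature.Analysis.OperatorTheory

namespace Summit.CriticalPhenomena.Ising3DConformalLimit.Cruxes.HRP2Rigidity.XRayMellin

section Reduction

variable {E : Type} [NormedAddCommGroup E] [InnerProductSpace ℝ E] {K : E → ℝ} {n y : E}

/-- The mirror reflection is linear, so it negates every multiple of the normal. [folklore] -/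
theorem reflection_smul_normal (n : E) (s : ℝ) : (ℝ ∙ n)ᗮ.reflection (s • n) = -(s • n) := by
  rw [map_smul, mirrorReflection_normal, smul_neg]

/-- `θ_n (s • n̂ + y) = -(s • n̂) + y` for `y ⊥ n`. [folklore] -/
theorem reflection_smul_unit_add (hy : ⟪y, n⟫_ℝ = 0) (s : ℝ) :
    (ℝ ∙ n)ᗮ.reflection (s • ‖n‖⁻¹ • n + y) = -(s • ‖n‖⁻¹ • n) + y := by
  rw [map_add, smul_smul, reflection_smul_normal, mirrorReflection_of_inner_eq_zero hy]

/-- `θ_n (s • n̂ - y) = -(s • n̂) - y` for `y ⊥ n`. [folklore] -/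
theorem reflection_smul_unit_sub (hy : ⟪y, n⟫_ℝ = 0) (s : ℝ) :
    (ℝ ∙ n)ᗮ.reflection (s • ‖n‖⁻¹ • n - y) = -(s • ‖n‖⁻¹ • n) - y := by
  rw [map_sub, smul_smul, reflection_smul_normal, mirrorReflection_of_inner_eq_zero hy]

/-- `⟪s • n̂, n⟫ = s ‖n‖`. [folklore] -/
theorem inner_smul_unit_normal (n : E) (s : ℝ) : ⟪s • ‖n‖⁻¹ • n, n⟫_ℝ = s * ‖n‖ := by
  rw [real_inner_smul_left, real_inner_smul_left, real_inner_self_eq_norm_sq]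
  by_cases h : ‖n‖ = 0
  · simp [h]
  · field_simp

/-- Evenness and `θ_n`-invariance give `K (s n̂ - y) = K (s n̂ + y)`. [folklore] -/
theorem apply_sub_eq_apply_add (heven : ∀ x, K (-x) = K x)
    (hinv : ∀ x, K ((ℝ ∙ n)ᗮ.reflection x) = K x) (hy : ⟪y, n⟫_ℝ = 0) (s : ℝ) :
    K (s • ‖n‖⁻¹ • n - y) = K (s • ‖n‖⁻¹ • n + y) := by
  rw [← hinv (s • ‖n‖⁻¹ • n + y), reflection_smul_unit_add hy, ← heven (s • ‖n‖⁻¹ • n - y)]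
  congr 1
  abel

/-- **The `2m`-point Gram computation.** For `s_a > 0`, real `c_a` and a sign `σ = ±1`, reflection
positivity on the configuration `{s_a n̂} ∪ {s_a n̂ - y}` with coefficients `(c, σ c)` gives
`0 ≤ ∑_ab c_a c_b (K((s_a+s_b) n̂) + σ K((s_a+s_b) n̂ + y))`. [folklore] -/
theorem sum_mul_mul_add_sign_nonneg (hn : n ≠ 0) (heven : ∀ x, K (-x) = K x)
    (hinv : ∀ x, K ((ℝ ∙ n)ᗮ.reflection x) = K x) (hRP : IsMirrorRPKernel n K) (hy : ⟪y, n⟫_ℝ = 0)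
    {σ : ℝ} (hσ : σ = 1 ∨ σ = -1) {m : ℕ} (s : Fin m → ℝ) (c : Fin m → ℝ) (hs : ∀ a, 0 < s a) :
    0 ≤ ∑ a, ∑ b, c a * c b *
      (K ((s a + s b) • ‖n‖⁻¹ • n) + σ * K ((s a + s b) • ‖n‖⁻¹ • n + y)) := by
  have hσ2 : σ * σ = 1 := by rcases hσ with rfl | rfl <;> norm_num
  have hnorm : 0 < ‖n‖ := norm_pos_iff.2 hn
  -- the configuration indexed by `Fin m ⊕ Fin m`
  set P : Fin m ⊕ Fin m → E := fun i => Sum.elim (fun a => s a • ‖n‖⁻¹ • n) (fun a => s a • ‖n‖⁻¹ • n - y) i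
    with hP
  set C : Fin m ⊕ Fin m → ℝ := fun i => Sum.elim c (fun a => σ * c a) i with hC
  have hpos : ∀ i, 0 < ⟪P i, n⟫_ℝ := by
    rintro (a | a)
    · simp only [hP, Sum.elim_inl, inner_smul_unit_normal]
      exact mul_pos (hs a) hnorm
    · simp only [hP, Sum.elim_inr, inner_sub_left, inner_smul_unit_normal, hy, sub_zero]
      exact mul_pos (hs a) hnorm
  have h := hRP.sum_nonneg P C hpos
  rw [Fintype.sum_sum_type] at h
  simp only [Fintype.sum_sum_type, hP, hC, Sum.elim_inl, Sum.elim_inr] at h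
  -- evaluate the four blocks
  have e11 : ∀ a b, s a • ‖n‖⁻¹ • n - (ℝ ∙ n)ᗮ.reflection (s b • ‖n‖⁻¹ • n) = (s a + s b) • ‖n‖⁻¹ • n := by
    intro a b
    simp only [smul_smul]
    rw [reflection_smul_normal, sub_neg_eq_add, ← add_smul]
    congr 1
    ring
  have e12 : ∀ a b, s a • ‖n‖⁻¹ • n - (ℝ ∙ n)ᗮ.reflection (s b • ‖n‖⁻¹ • n - y) =
      (s a + s b) • ‖n‖⁻¹ • n + y := by
    intro a b; rw [reflection_smul_unit_sub hy, add_smul]; abel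
  have e21 : ∀ a b, s a • ‖n‖⁻¹ • n - y - (ℝ ∙ n)ᗮ.reflection (s b • ‖n‖⁻¹ • n) =
      (s a + s b) • ‖n‖⁻¹ • n - y := by
    intro a b
    simp only [smul_smul]
    rw [reflection_smul_normal, add_mul, add_smul]
    abel
  have e22 : ∀ a b, s a • ‖n‖⁻¹ • n - y - (ℝ ∙ n)ᗮ.reflection (s b • ‖n‖⁻¹ • n - y) =
      (s a + s b) • ‖n‖⁻¹ • n := by
    intro a b; rw [reflection_smul_unit_sub hy, add_smul]; abel
  simp only [e11, e12, e21, e22, apply_sub_eq_apply_add heven hinv hy] at h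
  -- compare with `2 * (goal sum)`
  have hsum : (∑ a, (∑ b, c a * c b * K ((s a + s b) • ‖n‖⁻¹ • n) +
        ∑ b, c a * (σ * c b) * K ((s a + s b) • ‖n‖⁻¹ • n + y))) +
      (∑ a, (∑ b, σ * c a * c b * K ((s a + s b) • ‖n‖⁻¹ • n + y) +
        ∑ b, σ * c a * (σ * c b) * K ((s a + s b) • ‖n‖⁻¹ • n))) =
      2 * ∑ a, ∑ b, c a * c b * (K ((s a + s b) • ‖n‖⁻¹ • n) + σ * K ((s a + s b) • ‖n‖⁻¹ • n + y)) := by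
    rw [Finset.mul_sum, ← Finset.sum_add_distrib]
    refine Finset.sum_congr rfl fun a _ => ?_
    rw [Finset.mul_sum, ← Finset.sum_add_distrib, ← Finset.sum_add_distrib, ← Finset.sum_add_distrib]
    refine Finset.sum_congr rfl fun b _ => ?_
    linear_combination (c a * c b * K ((s a + s b) • ‖n‖⁻¹ • n)) * hσ2
  rw [hsum] at h
  linarith

/-- **`F_± (s) = K (s n̂) ± K (s n̂ + y)` are bounded positive-definite functions on the half-line.**
[folklore] -/
theorem isBoundedHalfLinePD_add_sign (hn : n ≠ 0) (heven : ∀ x, K (-x) = K x)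
    (hbdd : ∀ t₀ : ℝ, 0 < t₀ → ∃ M : ℝ, ∀ x : E, t₀ ≤ ⟪x, ‖n‖⁻¹ • n⟫_ℝ → |K x| ≤ M)
    (hinv : ∀ x, K ((ℝ ∙ n)ᗮ.reflection x) = K x) (hRP : IsMirrorRPKernel n K) (hy : ⟪y, n⟫_ℝ = 0)
    {σ : ℝ} (hσ : σ = 1 ∨ σ = -1) :
    IsBoundedHalfLinePD (fun s : ℝ => K (s • ‖n‖⁻¹ • n) + σ * K (s • ‖n‖⁻¹ • n + y)) := by
  have hnorm : 0 < ‖n‖ := norm_pos_iff.2 hn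
  have hunit : ⟪‖n‖⁻¹ • n, ‖n‖⁻¹ • n⟫_ℝ = 1 := by
    rw [real_inner_smul_left, real_inner_smul_right, real_inner_self_eq_norm_sq]
    field_simp
  have hyu : ⟪y, ‖n‖⁻¹ • n⟫_ℝ = 0 := by rw [real_inner_smul_right, hy, mul_zero]
  refine ⟨fun m s c hs => sum_mul_mul_add_sign_nonneg hn heven hinv hRP hy hσ s c hs, fun t₀ ht₀ => ?_⟩
  obtain ⟨M, hM⟩ := hbdd t₀ ht₀
  refine ⟨M + M, fun t ht => ?_⟩
  have h1 : |K (t • ‖n‖⁻¹ • n)| ≤ M := hM _ (by rw [real_inner_smul_left, hunit, mul_one]; exact ht)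
  have h2 : |K (t • ‖n‖⁻¹ • n + y)| ≤ M :=
    hM _ (by rw [inner_add_left, real_inner_smul_left, hunit, hyu, mul_one, add_zero]; exact ht)
  have hσ1 : |σ| = 1 := by rcases hσ with rfl | rfl <;> norm_num
  calc |K (t • ‖n‖⁻¹ • n) + σ * K (t • ‖n‖⁻¹ • n + y)|
      ≤ |K (t • ‖n‖⁻¹ • n)| + |σ * K (t • ‖n‖⁻¹ • n + y)| := abs_add_le _ _
    _ = |K (t • ‖n‖⁻¹ • n)| + |K (t • ‖n‖⁻¹ • n + y)| := by rw [abs_mul, hσ1, one_mul]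
    _ ≤ M + M := add_le_add h1 h2

end Reduction

/-- Registered stub `stub_halfPlaneContinuation` — **S1 · per-mirror half-plane continuation
(Bernstein–Widder; any real inner product space).**  For `K` even, bounded on every slab
`{⟪x, n̂⟫ ≥ t₀}` (`t₀ > 0`), invariant and reflection positive for ONE mirror `n ≠ 0`, and `y ⊥ n`:
`t ↦ K (t n̂ + y)` (`t > 0`) is the restriction of a function holomorphic on the open right
half-plane, bounded there by `K ((Re t) n̂)`.  Proof: `F_± = K (s n̂) ± K (s n̂ + y)` are bounded
positive-definite on `((0,∞),+)` (`isBoundedHalfLinePD_add_sign`), hence extend holomorphically with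
domination by their values at `Re t` (`IsBoundedHalfLinePD.exists_holomorphic_extension`), and
`F = (Φ₊ - Φ₋)/2`. -/
theorem stub_halfPlaneContinuation :
    ∀ (E : Type) [NormedAddCommGroup E] [InnerProductSpace ℝ E] (K : E → ℝ) (n : E), n ≠ 0 →
      ContinuousOn K {0}ᶜ → (∀ x, K (-x) = K x) →
      (∀ t₀ : ℝ, 0 < t₀ → ∃ M : ℝ, ∀ x : E, t₀ ≤ inner ℝ x (‖n‖⁻¹ • n) → |K x| ≤ M) →
      (∀ x, K (((ℝ ∙ n)ᗮ).reflection x) = K x) → Literature.MathematicalPhysics.QuantumFieldTheory.IsMirrorRPKernel n K →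
      ∀ y : E, inner ℝ y n = 0 →
        ∃ F : ℂ → ℂ, DifferentiableOn ℂ F {t : ℂ | 0 < t.re} ∧
          (∀ t : ℝ, 0 < t → F t = ((K (t • ‖n‖⁻¹ • n + y) : ℝ) : ℂ)) ∧
          (∀ t : ℂ, 0 < t.re → ‖F t‖ ≤ K (t.re • ‖n‖⁻¹ • n)) := by
  intro E _ _ K n hn _hK heven hbdd hinv hRP y hy
  obtain ⟨Φp, hΦp_diff, hΦp_real, hΦp_norm⟩ :=
    (isBoundedHalfLinePD_add_sign hn heven hbdd hinv hRP hy (σ := 1) (Or.inl rfl)).exists_holomorphic_extension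
  obtain ⟨Φm, hΦm_diff, hΦm_real, hΦm_norm⟩ :=
    (isBoundedHalfLinePD_add_sign hn heven hbdd hinv hRP hy (σ := -1) (Or.inr rfl)).exists_holomorphic_extension
  refine ⟨fun t => (Φp t - Φm t) / 2, (hΦp_diff.sub hΦm_diff).div_const 2, fun t ht => ?_, fun t ht => ?_⟩
  · simp only [hΦp_real t ht, hΦm_real t ht]
    push_cast
    ring
  · have h1 := hΦp_norm t ht
    have h2 := hΦm_norm t ht
    simp only [one_mul, neg_mul] at h1 h2
    calc ‖(Φp t - Φm t) / 2‖ = ‖Φp t - Φm t‖ / 2 := by rw [norm_div, Complex.norm_two]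
      _ ≤ (‖Φp t‖ + ‖Φm t‖) / 2 := by gcongr; exact norm_sub_le _ _
      _ ≤ K (t.re • ‖n‖⁻¹ • n) := by linarith

end Summit.CriticalPhenomena.Ising3DConformalLimit.Cruxes.HRP2Rigidity.XRayMellin

end
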